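import Mathlib

/-!
# Route `FilamentSkeletonRss` · crux `TransverseReduction1A` (stmt-27414; successor of the aside `TransverseReductionRJ`,
# stmt-21221) — line `kelvin_gate`: the SHARP SCALES are closed under the BILINEAR term and the BASE PERTURBATION

Helper file (theorems only, `--as helper`).  HONEST FRAMING: analysis bookkeeping for a HYPOTHETICAL filament-type rotating
self-similar blow-up route; nothing here bears on Navier–Stokes regularity; no stub is proved here.

The free Kelvin gate in the sharp scales (`…KelvinGateFreeGateSharp.free_kelvin_gate_sharp`) inverts `𝓛_(α,0) + ∇` from
`Y♯_a = {F ∈ C¹ : ⟨y⟩^{a+1}(‖F‖, ‖DF‖) ≤ R}` to `X♯_a = {W ∈ C² : ⟨y⟩‖W‖, ⟨y⟩^a‖DW‖, ⟨y⟩^a‖D²W‖ ≤ CR}` (`1 < a < 2`).  For the line's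
nonlinear closing (S3′) and for the gate at a non-trivial base (S2′: `𝓛_(α,U⁰) = 𝓛_(α,0) + (DW[U⁰] + DU⁰[W])`) one needs that the two
remaining terms of the profile operator map these scales into each other.  Pure bookkeeping (product rule + exponent count):

* `norm_fderiv_clm_apply_le` — `‖D(y ↦ c(y)(u(y)))‖ ≤ ‖c‖‖Du‖ + ‖Dc‖‖u‖`;
* `sharp_bilinear` — **`(W, W′) ↦ DW[W′]` maps `X♯_a × X♯_a → Y♯_a`**: `C¹`, `⟨y⟩^{a+1}‖DW[W′]‖ ≤ RR′`,
  `⟨y⟩^{a+1}‖D(DW[W′])‖ ≤ 2RR′` (uses `a ≥ 1`: `⟨y⟩^{a+1} ≤ ⟨y⟩^{2a}`);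
* `sharp_perturbation` — **`W ↦ DW[U] + DU[W]` maps `X♯_a → Y♯_a`** for a `C²` base with `⟨y⟩‖U‖, ⟨y⟩²‖DU‖, ⟨y⟩³‖D²U‖ ≤ M`
  (the decay of a Biot–Savart field of compactly supported vorticity and of the line's dressed skeleton fields): `C¹`,
  `⟨y⟩^{a+1}‖·‖ ≤ 2MR`, `⟨y⟩^{a+1}‖D·‖ ≤ 4MR` (uses `a ≤ 2`).
What is NOT here: smallness/compactness of the perturbation (the crux), the rate unknown, the contraction.
-/

set_option linter.dupNamespace false

noncomputable section

namespace Summit.NavierStokesRegularity.NavierStokesRegularity.Theorems.KelvinGate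

open Set Function Real

section SharpMaps

variable {W W' U : EuclideanSpace ℝ (Fin 3) → EuclideanSpace ℝ (Fin 3)} {a R R' M : ℝ}

/-! ## Product rule for `y ↦ c(y)(u(y))` and weight algebra -/

/-- `‖D(y ↦ c(y)(u(y)))(y)‖ ≤ ‖c(y)‖ ‖Du(y)‖ + ‖Dc(y)‖ ‖u(y)‖` for differentiable `c : E → (E →L E)`, `u : E → E`. -/
theorem norm_fderiv_clm_apply_le {c : EuclideanSpace ℝ (Fin 3) → EuclideanSpace ℝ (Fin 3) →L[ℝ] EuclideanSpace ℝ (Fin 3)}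
    {u : EuclideanSpace ℝ (Fin 3) → EuclideanSpace ℝ (Fin 3)} {y : EuclideanSpace ℝ (Fin 3)}
    (hc : DifferentiableAt ℝ c y) (hu : DifferentiableAt ℝ u y) :
    ‖fderiv ℝ (fun y => c y (u y)) y‖ ≤ ‖c y‖ * ‖fderiv ℝ u y‖ + ‖fderiv ℝ c y‖ * ‖u y‖ := by
  rw [fderiv_clm_apply hc hu]
  refine (norm_add_le _ _).trans (add_le_add (ContinuousLinearMap.opNorm_comp_le _ _) ?_)
  calc ‖(fderiv ℝ c y).flip (u y)‖ ≤ ‖(fderiv ℝ c y).flip‖ * ‖u y‖ := ContinuousLinearMap.le_opNorm _ _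
    _ = ‖fderiv ℝ c y‖ * ‖u y‖ := by rw [ContinuousLinearMap.opNorm_flip]

/-- Weight monotonicity: `(1+|y|)^p ≤ (1+|y|)^q` for `p ≤ q`. -/
theorem weight_rpow_mono {p q : ℝ} (hpq : p ≤ q) (y : EuclideanSpace ℝ (Fin 3)) : (1 + ‖y‖) ^ p ≤ (1 + ‖y‖) ^ q :=
  Real.rpow_le_rpow_of_exponent_le (by linarith [norm_nonneg y]) hpq

/-- `(1+|y|)^{p+q} = (1+|y|)^p (1+|y|)^q`. -/
theorem weight_rpow_add (p q : ℝ) (y : EuclideanSpace ℝ (Fin 3)) : (1 + ‖y‖) ^ (p + q) = (1 + ‖y‖) ^ p * (1 + ‖y‖) ^ q :=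
  Real.rpow_add (by positivity) p q

/-- `(1+|y|)^{a+1} = (1+|y|)^a (1+|y|)`. -/
theorem weight_rpow_add_one (a : ℝ) (y : EuclideanSpace ℝ (Fin 3)) : (1 + ‖y‖) ^ (a + 1) = (1 + ‖y‖) ^ a * (1 + ‖y‖) := by
  rw [weight_rpow_add, Real.rpow_one]

/-- The basic product estimate: if `(1+|y|)^p A ≤ R₁`, `(1+|y|)^q B ≤ S₁` (`A, B ≥ 0`) and `r ≤ p + q`, then
`(1+|y|)^r A B ≤ R₁ S₁`. -/
theorem weight_rpow_mul_mul_le {p q r A B R₁ S₁ : ℝ} (y : EuclideanSpace ℝ (Fin 3)) (hA : 0 ≤ A) (hB : 0 ≤ B) (hr : r ≤ p + q)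
    (h1 : (1 + ‖y‖) ^ p * A ≤ R₁) (h2 : (1 + ‖y‖) ^ q * B ≤ S₁) : (1 + ‖y‖) ^ r * (A * B) ≤ R₁ * S₁ := by
  have hp : 0 ≤ (1 + ‖y‖) ^ p * A := by positivity
  calc (1 + ‖y‖) ^ r * (A * B) ≤ (1 + ‖y‖) ^ (p + q) * (A * B) :=
        mul_le_mul_of_nonneg_right (weight_rpow_mono hr y) (by positivity)
    _ = ((1 + ‖y‖) ^ p * A) * ((1 + ‖y‖) ^ q * B) := by rw [weight_rpow_add]; ring
    _ ≤ R₁ * S₁ := mul_le_mul h1 h2 (by positivity) (le_trans hp h1)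

/-! ## The bilinear term -/

/-- **`DW[W′] : X♯_a × X♯_a → Y♯_a`** (`1 ≤ a`).  For `W ∈ C²`, `W′ ∈ C¹` with `⟨y⟩^a‖DW‖ ≤ R`, `⟨y⟩^a‖D²W‖ ≤ R`,
`⟨y⟩‖W′‖ ≤ R′`, `⟨y⟩^a‖DW′‖ ≤ R′`: the field `y ↦ DW(y)[W′(y)]` is `C¹` with `⟨y⟩^{a+1}‖DW[W′]‖ ≤ RR′` and
`⟨y⟩^{a+1}‖D(DW[W′])‖ ≤ 2RR′`. -/
theorem sharp_bilinear (ha1 : 1 ≤ a) (hW : ContDiff ℝ 2 W) (hW' : ContDiff ℝ 1 W')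
    (hW1 : ∀ y, (1 + ‖y‖) ^ a * ‖fderiv ℝ W y‖ ≤ R) (hW2 : ∀ y, (1 + ‖y‖) ^ a * ‖fderiv ℝ (fderiv ℝ W) y‖ ≤ R)
    (hW'0 : ∀ y, (1 + ‖y‖) * ‖W' y‖ ≤ R') (hW'1 : ∀ y, (1 + ‖y‖) ^ a * ‖fderiv ℝ W' y‖ ≤ R') :
    ContDiff ℝ 1 (fun y => fderiv ℝ W y (W' y)) ∧
    (∀ y, (1 + ‖y‖) ^ (a + 1) * ‖fderiv ℝ W y (W' y)‖ ≤ R * R') ∧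
    (∀ y, (1 + ‖y‖) ^ (a + 1) * ‖fderiv ℝ (fun y => fderiv ℝ W y (W' y)) y‖ ≤ 2 * R * R') := by
  have hDW : ContDiff ℝ 1 (fderiv ℝ W) := hW.fderiv_right (m := 1) le_rfl
  have hW'0' : ∀ y, (1 + ‖y‖) ^ (1:ℝ) * ‖W' y‖ ≤ R' := fun y => by rw [Real.rpow_one]; exact hW'0 y
  refine ⟨hDW.clm_apply hW', fun y => ?_, fun y => ?_⟩
  · calc (1 + ‖y‖) ^ (a + 1) * ‖fderiv ℝ W y (W' y)‖ ≤ (1 + ‖y‖) ^ (a + 1) * (‖fderiv ℝ W y‖ * ‖W' y‖) :=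
          mul_le_mul_of_nonneg_left (ContinuousLinearMap.le_opNorm _ _) (by positivity)
      _ ≤ R * R' := weight_rpow_mul_mul_le y (norm_nonneg _) (norm_nonneg _) le_rfl (hW1 y) (hW'0' y)
  · have h := norm_fderiv_clm_apply_le ((hDW.differentiable one_ne_zero) y) ((hW'.differentiable one_ne_zero) y)
    have t1 : (1 + ‖y‖) ^ (a + 1) * (‖fderiv ℝ W y‖ * ‖fderiv ℝ W' y‖) ≤ R * R' :=
      weight_rpow_mul_mul_le y (norm_nonneg _) (norm_nonneg _) (by linarith) (hW1 y) (hW'1 y)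
    have t2 : (1 + ‖y‖) ^ (a + 1) * (‖fderiv ℝ (fderiv ℝ W) y‖ * ‖W' y‖) ≤ R * R' :=
      weight_rpow_mul_mul_le y (norm_nonneg (fderiv ℝ (fderiv ℝ W) y)) (norm_nonneg (W' y)) le_rfl (hW2 y) (hW'0' y)
    calc (1 + ‖y‖) ^ (a + 1) * ‖fderiv ℝ (fun y => fderiv ℝ W y (W' y)) y‖
        ≤ (1 + ‖y‖) ^ (a + 1) * (‖fderiv ℝ W y‖ * ‖fderiv ℝ W' y‖ + ‖fderiv ℝ (fderiv ℝ W) y‖ * ‖W' y‖) :=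
          mul_le_mul_of_nonneg_left h (by positivity)
      _ = (1 + ‖y‖) ^ (a + 1) * (‖fderiv ℝ W y‖ * ‖fderiv ℝ W' y‖) +
            (1 + ‖y‖) ^ (a + 1) * (‖fderiv ℝ (fderiv ℝ W) y‖ * ‖W' y‖) := by ring
      _ ≤ R * R' + R * R' := add_le_add t1 t2
      _ = 2 * R * R' := by ring

/-! ## The base perturbation -/

/-- **`W ↦ DW[U] + DU[W] : X♯_a → Y♯_a`** (`a ≤ 2`).  For a `C²` base `U` with `⟨y⟩‖U‖ ≤ M`, `⟨y⟩²‖DU‖ ≤ M`,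
`⟨y⟩³‖D²U‖ ≤ M` and `W ∈ C²` with `⟨y⟩‖W‖ ≤ R`, `⟨y⟩^a‖DW‖ ≤ R`, `⟨y⟩^a‖D²W‖ ≤ R`: the field `y ↦ DW(y)[U(y)] + DU(y)[W(y)]`
is `C¹` with `⟨y⟩^{a+1}‖·‖ ≤ 2MR` and `⟨y⟩^{a+1}‖D·‖ ≤ 4MR`. -/
theorem sharp_perturbation (ha2 : a ≤ 2) (hU : ContDiff ℝ 2 U)
    (hU0 : ∀ y, (1 + ‖y‖) * ‖U y‖ ≤ M) (hU1 : ∀ y, (1 + ‖y‖) ^ 2 * ‖fderiv ℝ U y‖ ≤ M)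
    (hU2 : ∀ y, (1 + ‖y‖) ^ 3 * ‖fderiv ℝ (fderiv ℝ U) y‖ ≤ M)
    (hW : ContDiff ℝ 2 W) (hW0 : ∀ y, (1 + ‖y‖) * ‖W y‖ ≤ R) (hW1 : ∀ y, (1 + ‖y‖) ^ a * ‖fderiv ℝ W y‖ ≤ R)
    (hW2 : ∀ y, (1 + ‖y‖) ^ a * ‖fderiv ℝ (fderiv ℝ W) y‖ ≤ R) :
    ContDiff ℝ 1 (fun y => fderiv ℝ W y (U y) + fderiv ℝ U y (W y)) ∧
    (∀ y, (1 + ‖y‖) ^ (a + 1) * ‖fderiv ℝ W y (U y) + fderiv ℝ U y (W y)‖ ≤ 2 * M * R) ∧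
    (∀ y, (1 + ‖y‖) ^ (a + 1) * ‖fderiv ℝ (fun y => fderiv ℝ W y (U y) + fderiv ℝ U y (W y)) y‖ ≤ 4 * M * R) := by
  have hDW : ContDiff ℝ 1 (fderiv ℝ W) := hW.fderiv_right (m := 1) le_rfl
  have hDU : ContDiff ℝ 1 (fderiv ℝ U) := hU.fderiv_right (m := 1) le_rfl
  have hW1' : ContDiff ℝ 1 W := hW.of_le (by norm_num)
  have hU1' : ContDiff ℝ 1 U := hU.of_le (by norm_num)
  -- the base bounds at real exponents
  have hU0r : ∀ y, (1 + ‖y‖) ^ (1:ℝ) * ‖U y‖ ≤ M := fun y => by rw [Real.rpow_one]; exact hU0 y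
  have hU1r : ∀ y, (1 + ‖y‖) ^ (2:ℝ) * ‖fderiv ℝ U y‖ ≤ M := fun y => by
    rw [show ((2:ℝ)) = ((2:ℕ):ℝ) by norm_num, Real.rpow_natCast]; exact hU1 y
  have hU2r : ∀ y, (1 + ‖y‖) ^ (3:ℝ) * ‖fderiv ℝ (fderiv ℝ U) y‖ ≤ M := fun y => by
    rw [show ((3:ℝ)) = ((3:ℕ):ℝ) by norm_num, Real.rpow_natCast]; exact hU2 y
  have hW0r : ∀ y, (1 + ‖y‖) ^ (1:ℝ) * ‖W y‖ ≤ R := fun y => by rw [Real.rpow_one]; exact hW0 y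
  have hA : ContDiff ℝ 1 (fun y => fderiv ℝ W y (U y)) := hDW.clm_apply hU1'
  have hB : ContDiff ℝ 1 (fun y => fderiv ℝ U y (W y)) := hDU.clm_apply hW1'
  refine ⟨hA.add hB, fun y => ?_, fun y => ?_⟩
  · have t1 : (1 + ‖y‖) ^ (a + 1) * (‖fderiv ℝ W y‖ * ‖U y‖) ≤ R * M :=
      weight_rpow_mul_mul_le y (norm_nonneg _) (norm_nonneg _) le_rfl (hW1 y) (hU0r y)
    have t2 : (1 + ‖y‖) ^ (a + 1) * (‖fderiv ℝ U y‖ * ‖W y‖) ≤ M * R :=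
      weight_rpow_mul_mul_le y (norm_nonneg _) (norm_nonneg _) (by linarith) (hU1r y) (hW0r y)
    calc (1 + ‖y‖) ^ (a + 1) * ‖fderiv ℝ W y (U y) + fderiv ℝ U y (W y)‖
        ≤ (1 + ‖y‖) ^ (a + 1) * (‖fderiv ℝ W y‖ * ‖U y‖ + ‖fderiv ℝ U y‖ * ‖W y‖) :=
          mul_le_mul_of_nonneg_left ((norm_add_le _ _).trans
            (add_le_add (ContinuousLinearMap.le_opNorm _ _) (ContinuousLinearMap.le_opNorm _ _))) (by positivity)
      _ = (1 + ‖y‖) ^ (a + 1) * (‖fderiv ℝ W y‖ * ‖U y‖) + (1 + ‖y‖) ^ (a + 1) * (‖fderiv ℝ U y‖ * ‖W y‖) := by ring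
      _ ≤ R * M + M * R := add_le_add t1 t2
      _ = 2 * M * R := by ring
  · have hdA := (hA.differentiable one_ne_zero) y
    have hdB := (hB.differentiable one_ne_zero) y
    rw [fderiv_fun_add hdA hdB]
    have hnA := norm_fderiv_clm_apply_le ((hDW.differentiable one_ne_zero) y) ((hU1'.differentiable one_ne_zero) y)
    have hnB := norm_fderiv_clm_apply_le ((hDU.differentiable one_ne_zero) y) ((hW1'.differentiable one_ne_zero) y)
    have t1 : (1 + ‖y‖) ^ (a + 1) * (‖fderiv ℝ W y‖ * ‖fderiv ℝ U y‖) ≤ R * M :=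
      weight_rpow_mul_mul_le y (norm_nonneg _) (norm_nonneg _) (by linarith) (hW1 y) (hU1r y)
    have t2 : (1 + ‖y‖) ^ (a + 1) * (‖fderiv ℝ (fderiv ℝ W) y‖ * ‖U y‖) ≤ R * M :=
      weight_rpow_mul_mul_le y (norm_nonneg (fderiv ℝ (fderiv ℝ W) y)) (norm_nonneg (U y)) le_rfl (hW2 y) (hU0r y)
    have t3 : (1 + ‖y‖) ^ (a + 1) * (‖fderiv ℝ U y‖ * ‖fderiv ℝ W y‖) ≤ M * R :=
      weight_rpow_mul_mul_le y (norm_nonneg _) (norm_nonneg _) (by linarith) (hU1r y) (hW1 y)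
    have t4 : (1 + ‖y‖) ^ (a + 1) * (‖fderiv ℝ (fderiv ℝ U) y‖ * ‖W y‖) ≤ M * R :=
      weight_rpow_mul_mul_le y (norm_nonneg (fderiv ℝ (fderiv ℝ U) y)) (norm_nonneg (W y)) (by linarith) (hU2r y) (hW0r y)
    calc (1 + ‖y‖) ^ (a + 1) * ‖fderiv ℝ (fun y => fderiv ℝ W y (U y)) y + fderiv ℝ (fun y => fderiv ℝ U y (W y)) y‖
        ≤ (1 + ‖y‖) ^ (a + 1) * ((‖fderiv ℝ W y‖ * ‖fderiv ℝ U y‖ + ‖fderiv ℝ (fderiv ℝ W) y‖ * ‖U y‖) +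
            (‖fderiv ℝ U y‖ * ‖fderiv ℝ W y‖ + ‖fderiv ℝ (fderiv ℝ U) y‖ * ‖W y‖)) :=
          mul_le_mul_of_nonneg_left ((norm_add_le _ _).trans (add_le_add hnA hnB)) (by positivity)
      _ = (1 + ‖y‖) ^ (a + 1) * (‖fderiv ℝ W y‖ * ‖fderiv ℝ U y‖) +
            (1 + ‖y‖) ^ (a + 1) * (‖fderiv ℝ (fderiv ℝ W) y‖ * ‖U y‖) +
            ((1 + ‖y‖) ^ (a + 1) * (‖fderiv ℝ U y‖ * ‖fderiv ℝ W y‖) +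
            (1 + ‖y‖) ^ (a + 1) * (‖fderiv ℝ (fderiv ℝ U) y‖ * ‖W y‖)) := by ring
      _ ≤ R * M + R * M + (M * R + M * R) := add_le_add (add_le_add t1 t2) (add_le_add t3 t4)
      _ = 4 * M * R := by ring

end SharpMaps

end Summit.NavierStokesRegularity.NavierStokesRegularity.Theorems.KelvinGate

end
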